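import Summits.KontsevichZagierPeriods.KontsevichZagierPeriods.Theses.UnfoldedStokes
import Summits.KontsevichZagierPeriods.KontsevichZagierPeriods.Theorems.StokesGeneration.Negative.CovDomainAddLoadBearing
import Summits.KontsevichZagierPeriods.KontsevichZagierPeriods.Theorems.CompleteModGammaSector.Negative.DimZeroInvariant
import Summits.KontsevichZagierPeriods.KontsevichZagierPeriods.Theorems.StuffleInKZ.Negative.IntegrandAdditivityDerived
import Summits.KontsevichZagierPeriods.KontsevichZagierPeriods.Theorems.UnfoldedStokesStokesGenerationStubSpanToReps
import Literature.NumberTheory.Transcendental.KZLogCalculusProofs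

/-!
# `ContinuousCubification` (stmt-KontsevichZagierPeriods-17853) — negative side: which moves bear load,
and the sign-respecting strengthening is summit-hard

Landed copy of §A and §C of `Cruxes/ContinuousCubification/Disproof.lean` (cdisprove cycle 1,
route UnfoldedStokes). The crux — every formal combination is congruent modulo `KZ.relations` to ONE
closed-cube representation `[[0,1]^M, h]` with `h` continuous on the closed cube — has no hypothesis
to drop; its only structural datum is the move set `relations = closure ((1a) ∪ (1b) ∪ (2) ∪ (3))`.
Complete picture of the generator list:

* rule (3) Newton–Leibniz is LOAD-BEARING, unconditionally and in the strongest form: modulo rules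
  (1a), (1b), (2) there is no single-representation normal form at all
  (`not_singleRepNormalForm_rulesOneTwo`, invariants `ev₀` and `eval`, witness `[pt,1] + [[0,1],1]`);
* rule (2) change of variables is LOAD-BEARING, unconditionally: modulo rules (1a), (1b), (3) no
  cube normal form exists (`not_cubeNormalForm_rulesOneThree`, tree invariant `covKer`, witness
  `[[2,3], 1/(4−t)]`) — rule (2) is needed already to translate a domain into the cube;
* rule (1a) domain additivity is LOAD-BEARING modulo van den Dries Ch. 4 (2.4)
  (`not_cubeNormalForm_rulesNoDomainAdd`, tree invariant `evenEulerEval` and the new computation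
  `realEuler_closedCube : E([0,1]^M) = 1`, witness `[[0,1]∪[2,3], 1]`);
* rule (1b) integrand additivity is REDUNDANT (`continuousCubification_iff_without_integrandAdd`, from
  the tree's `relations_eq_closure_three_rules`);
* the SIGN-RESPECTING strengthening (non-negative normal form whenever `eval x ≥ 0`) implies the
  kernel conjecture (`kzKernelConjecture_of_signed`), hence the summit: planners should not ask for it.

References: M. Kontsevich, D. Zagier, *Periods* (2001), §1.2; L. van den Dries, *Tame topology and
o-minimal structures* (1998), Ch. 4 (2.4), (2.11); J. Ayoub, *Une version relative de la conjecture
des périodes de Kontsevich–Zagier*, Ann. of Math. 181 (2015), Rem. 1.2.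
-/
noncomputable section

namespace Summit.KontsevichZagierPeriods.UnfoldedStokes.ContinuousCubificationNegative

open MeasureTheory Set
open scoped Topology
open Literature.NumberTheory.Transcendental
open Literature.NumberTheory.Transcendental.KZ
open Literature.ModelTheory.ExponentialFields
open Summit.KontsevichZagierPeriods.KontsevichZagierPeriods.Theses.UnfoldedStokes
  (ContinuousCubification)
open Summit.KontsevichZagierPeriods.CompleteModGammaSectorNegative
open Summit.KontsevichZagierPeriods.UnfoldedStokes.StokesGenerationNegative
  (of_mem_covKer_of_first_le_two)
open Literature.Barriers.KontsevichZagierPeriods.KZ (constRep constRep_value)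
open Summit.KontsevichZagierPeriods.KontsevichZagierPeriods.StokesGenerationLine
  (isSemialgebraic_cubePi)
open FirstOrder FirstOrder.Language

/-- The closed unit cube `[0,1]^M` in the crux's own spelling. -/
abbrev cube (M : ℕ) : Set (Fin M → ℝ) := Set.pi Set.univ (fun _ : Fin M => Set.Icc (0:ℝ) 1)

/-! ## Normal-form shapes -/

/-- The crux, unfolded (by `Iff.rfl`): a one-cube normal form with continuous integrand modulo
`relations`. No hypothesis on `x`; the only structural datum is the subgroup `relations`.
[cite: KontsevichZagier2001, §1.2] -/
theorem continuousCubification_iff :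
    ContinuousCubification ↔ ∀ x : FormalRep, ∃ (M : ℕ) (t : IntegralRep M),
      t.domain = cube M ∧ ContinuousOn t.integrand t.domain ∧ x - of t ∈ relations :=
  Iff.rfl

/-- One-cube normal form modulo a subgroup `H`, with NO regularity asked of the integrand. -/
def CubeNormalForm (H : AddSubgroup FormalRep) : Prop :=
  ∀ x : FormalRep, ∃ (M : ℕ) (t : IntegralRep M), t.domain = cube M ∧ x - of t ∈ H

/-- Single-representation normal form modulo `H` (no condition on the representation at all). -/
def SingleRepNormalForm (H : AddSubgroup FormalRep) : Prop :=
  ∀ x : FormalRep, ∃ (M : ℕ) (t : IntegralRep M), x - of t ∈ H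

/-- The crux with `relations` replaced by an arbitrary subgroup `H` (used below with `H` = the
closure of three of the four move sets). -/
def ContinuousCubificationMod (H : AddSubgroup FormalRep) : Prop :=
  ∀ x : FormalRep, ∃ (M : ℕ) (t : IntegralRep M),
    t.domain = cube M ∧ ContinuousOn t.integrand t.domain ∧ x - of t ∈ H

/-- `ContinuousCubificationMod relations` is the crux. [folklore] -/
theorem continuousCubificationMod_relations_iff :
    ContinuousCubificationMod relations ↔ ContinuousCubification := Iff.rfl

/-- Forgetting continuity. [folklore] -/
theorem cubeNormalForm_of_continuousCubificationMod {H : AddSubgroup FormalRep}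
    (h : ContinuousCubificationMod H) : CubeNormalForm H := fun x => by
  obtain ⟨M, t, hd, -, hx⟩ := h x
  exact ⟨M, t, hd, hx⟩

/-- Forgetting the cube. [folklore] -/
theorem singleRepNormalForm_of_cubeNormalForm {H : AddSubgroup FormalRep} (h : CubeNormalForm H) :
    SingleRepNormalForm H := fun x => by
  obtain ⟨M, t, -, hx⟩ := h x
  exact ⟨M, t, hx⟩

/-- Monotonicity in the subgroup. [folklore] -/
theorem ContinuousCubificationMod.mono {H H' : AddSubgroup FormalRep} (hle : H ≤ H')
    (h : ContinuousCubificationMod H) : ContinuousCubificationMod H' := fun x => by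
  obtain ⟨M, t, hd, hc, hx⟩ := h x
  exact ⟨M, t, hd, hc, hle hx⟩

/-! ## Load-bearing analysis: which move sets a proof must use

`rulesOneTwo = closure ((1a) ∪ (1b) ∪ (2))`, `rulesOneThree = closure ((1a) ∪ (1b) ∪ (3))`,
`rulesNoDomainAdd = closure ((1b) ∪ (2) ∪ (3))` are the tree's subgroups
(`CompleteModGammaSectorNegative`). -/

/-! ### Rule (3), Newton–Leibniz: load-bearing (unconditional) -/

/-- **Without Newton–Leibniz there is no single-representation normal form at all.** The
dimension-0 evaluation `ev₀` and the full evaluation `eval` both kill rules (1a), (1b), (2); on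
`x = [pt, 1] + [[0,1], 1]` they read `1` and `2`. If `x − [t] ∈ rulesOneTwo` with `t` of dimension
`M`: for `M = 0`, `ev₀` gives `t.value = 1` and `eval` gives `t.value = 2`; for `M ≥ 1`, `ev₀` gives
`1 = 0`. [cite: KontsevichZagier2001, §1.2 rule (3)] -/
theorem not_singleRepNormalForm_rulesOneTwo : ¬ SingleRepNormalForm rulesOneTwo := by
  intro h
  obtain ⟨M, t, ht⟩ := h (of (constRep 1) + of unitIntervalRep)
  have h0 : ev₀ (of (constRep 1) + of unitIntervalRep - of t) = 0 := rulesOneTwo_le_ker_ev₀ ht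
  have h1 : eval (of (constRep 1) + of unitIntervalRep - of t) = 0 :=
    relations_le_ker_eval_holds (rulesOneTwo_le_relations ht)
  rw [map_sub, map_add, ev₀_of_zero, constRep_value, ev₀_of_eq_zero one_ne_zero unitIntervalRep]
    at h0
  rw [map_sub, map_add, eval_of, eval_of, eval_of, constRep_value, unitIntervalRep_value] at h1
  rcases Nat.eq_zero_or_pos M with hM | hM
  · rw [ev₀_of_eq_value hM] at h0
    push_cast at h0 h1
    linarith
  · rw [ev₀_of_eq_zero hM.ne'] at h0
    push_cast at h0
    linarith

/-- A fortiori no cube normal form without rule (3). [folklore] -/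
theorem not_cubeNormalForm_rulesOneTwo : ¬ CubeNormalForm rulesOneTwo := fun h =>
  not_singleRepNormalForm_rulesOneTwo (singleRepNormalForm_of_cubeNormalForm h)

/-- The crux with rule (3) removed from the move set. -/
def ContinuousCubificationWithoutNewtonLeibniz : Prop := ContinuousCubificationMod rulesOneTwo

/-- **NEWTON–LEIBNIZ IS LOAD-BEARING for `ContinuousCubification`** (unconditional).
[cite: KontsevichZagier2001, §1.2 rule (3)] -/
theorem continuousCubification_false_without_newtonLeibniz :
    ¬ ContinuousCubificationWithoutNewtonLeibniz := fun h =>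
  not_cubeNormalForm_rulesOneTwo (cubeNormalForm_of_continuousCubificationMod h)

/-! ### Rule (2), change of variables: load-bearing (unconditional) -/

/-- **Every closed-cube representation lies in `covKer`**: its domain sits in `{x₀ ≤ 1}`, so its
first-coordinate distribution function is constant (`= value`) on the window `[2,3]`; in dimension
`0` it is `0`. [folklore] -/
theorem of_cube_mem_covKer {M : ℕ} (t : IntegralRep M) (ht : t.domain = cube M) :
    of t ∈ covKer := by
  rcases Nat.eq_zero_or_pos M with hM | hM
  · rw [mem_covKer_iff, Cdf_of_eq_zero hM]
    exact WindowSemialg.zero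
  · refine of_mem_covKer_of_first_le_two hM t fun x hx => ?_
    rw [ht, Set.mem_univ_pi] at hx
    have h01 := (hx ⟨0, hM⟩).2
    linarith

/-- `[[0,1], 1/(2−t)]` lies in `covKer` (its distribution function is constant on the window).
[folklore] -/
theorem of_r₀_mem_covKer : of r₀ ∈ covKer := by
  rw [mem_covKer_iff]
  exact WindowSemialg.of_const r₀.value fun s hs => Cdf_r₀ hs

/-- **`[[2,3], 1/(4−t)]` does NOT lie in `covKer`**: its distribution function on the window is
`log 2 − log (2 − s)`, not `ℝ`-semialgebraic (tree: `witness_not_mem_covKer`, from the barrier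
`noRealSemialgebraicPrimitive_inv_sub_two`). [cite: Ayoub2015, Rem. 1.2] -/
theorem of_r₀'_not_mem_covKer : of r₀' ∉ covKer := fun h =>
  witness_not_mem_covKer (covKer.sub_mem of_r₀_mem_covKer h)

/-- **Without change of variables there is no cube normal form** (continuous, bounded or
otherwise): `rulesOneThree ≤ covKer` (tree), every closed-cube representation lies in `covKer`,
but `[[2,3], 1/(4−t)]` does not. Rule (2) is needed already to move a domain into the unit cube.
[cite: KontsevichZagier2001, §1.2 rule (2)] -/
theorem not_cubeNormalForm_rulesOneThree : ¬ CubeNormalForm rulesOneThree := by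
  intro h
  obtain ⟨M, t, htd, ht⟩ := h (of r₀')
  have h1 : of r₀' - of t ∈ covKer := rulesOneThree_le_covKer ht
  have h2 : of r₀' - of t + of t ∈ covKer := covKer.add_mem h1 (of_cube_mem_covKer t htd)
  rw [sub_add_cancel] at h2
  exact of_r₀'_not_mem_covKer h2

/-- The crux with rule (2) removed from the move set. -/
def ContinuousCubificationWithoutChangeOfVariables : Prop := ContinuousCubificationMod rulesOneThree

/-- **CHANGE OF VARIABLES IS LOAD-BEARING for `ContinuousCubification`** (unconditional).
[cite: KontsevichZagier2001, §1.2 rule (2)] -/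
theorem continuousCubification_false_without_changeOfVariables :
    ¬ ContinuousCubificationWithoutChangeOfVariables := fun h =>
  not_cubeNormalForm_rulesOneThree (cubeNormalForm_of_continuousCubificationMod h)

/-! ### Rule (1a), domain additivity: load-bearing modulo van den Dries Ch. 4 (2.4) -/

/-- Membership in the closed cube of `ℝ^{M+1}` splits along `Fin.append`. [folklore] -/
theorem append_mem_cube_iff {M : ℕ} (a : Fin M → ℝ) (y : Fin 1 → ℝ) :
    (Fin.append a y : Fin (M + 1) → ℝ) ∈ cube (M + 1) ↔ a ∈ cube M ∧ y 0 ∈ Icc (0:ℝ) 1 := by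
  simp only [cube, Set.mem_univ_pi]
  rw [Fin.forall_fin_add]
  simp only [Fin.append_left, Fin.append_right, Fin.forall_fin_one]

/-- **`E([0,1]^M) = 1`** (o-minimal Euler characteristic; fibre formula with closed fibres `[0,1]`
of Euler characteristic `1`, induction on `M`). NEW (the tree had the open cube, `(−1)^M`).
[cite: Dries1998, Ch. 4 (2.11)] -/
theorem realEuler_closedCube : ∀ M : ℕ, realEuler M (cube M) = 1
  | 0 => by
    have h := realEuler_box (m := 0) Fin.elim0 Fin.elim0 (fun i => i.elim0)
    have hset : {v : Fin 0 → ℝ | ∀ i, Fin.elim0 i < v i ∧ v i < Fin.elim0 i} = cube 0 := by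
      ext v
      simp [cube]
    rwa [hset, pow_zero] at h
  | M + 1 => by
    have hS : (univ : Set ℝ).Definable Language.orderedRing (cube (M + 1)) :=
      definable_univ_of_isSemialgebraic (isSemialgebraic_cubePi (M + 1))
    have hproj : {a : Fin M → ℝ | ∃ y : Fin 1 → ℝ, (Fin.append a y : Fin (M + 1) → ℝ) ∈ cube (M + 1)}
        = cube M := by
      ext a
      simp only [mem_setOf_eq, append_mem_cube_iff]
      constructor
      · rintro ⟨y, hy⟩
        exact hy.1
      · intro ha
        exact ⟨fun _ => 0, ha, le_rfl, zero_le_one⟩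
    rw [realEuler, eulerChar_eq_eulerChar_proj_mul isOMinimal_real definable_lt_real hS (e := 1)
      fun a ⟨y, hy⟩ => ?_, hproj, mul_one]
    · exact realEuler_closedCube M
    · have ha : a ∈ cube M := ((append_mem_cube_iff a y).1 hy).1
      have hset : {y : Fin 1 → ℝ | (Fin.append a y : Fin (M + 1) → ℝ) ∈ cube (M + 1)} =
          {y | (0:ℝ) ≤ y 0 ∧ y 0 ≤ 1} := by
        ext y
        simp only [mem_setOf_eq, append_mem_cube_iff, mem_Icc]
        exact ⟨fun h => h.2, fun h => ⟨ha, h⟩⟩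
      rw [hset]
      exact realEuler_Icc zero_le_one

/-- **Every closed-cube representation is killed by the Euler-parity-weighted evaluation**
(`E([0,1]^M) = 1` is odd; unconditional). [folklore] -/
theorem evenEulerEval_of_cube {M : ℕ} (t : IntegralRep M) (ht : t.domain = cube M) :
    evenEulerEval (of t) = 0 := by
  have h1 : ¬ Even (realEuler M t.domain) := by
    rw [ht, realEuler_closedCube M, Int.not_even_iff_odd]
    exact odd_one
  rw [evenEulerEval_of, if_neg h1]

/-- **Without domain additivity there is no cube normal form**, modulo van den Dries Ch. 4 (2.4)
(Euler invariance under injective definable maps, the named fact rule (2) needs to preserve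
`evenEulerEval`): `evenEulerEval` kills rules (1b), (2), (3) and every closed-cube generator, but
reads `2` on `[[0,1]∪[2,3], 1]` (`E = 2`, value `2`). [cite: Dries1998, Ch. 4 (2.4)] -/
theorem not_cubeNormalForm_rulesNoDomainAdd (hE : Dries1998_ch4_prop_2_4 Language.orderedRing ℝ) :
    ¬ CubeNormalForm rulesNoDomainAdd := by
  intro h
  obtain ⟨M, t, htd, ht⟩ := h (of twoIntervalsRep)
  have h0 : evenEulerEval (of twoIntervalsRep - of t) = 0 := rulesNoDomainAdd_le_ker hE ht
  have h2 : evenEulerEval (of twoIntervalsRep) = 2 := by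
    have hw := evenEulerEval_witness
    rw [map_sub] at hw
    have h1 : ¬ Even (realEuler 1 oneIntervalRep.domain) := by
      rw [realEuler_oneInterval, Int.not_even_iff_odd]
      exact odd_one
    rw [evenEulerEval_of oneIntervalRep, if_neg h1, sub_zero] at hw
    exact hw
  rw [map_sub, h2, evenEulerEval_of_cube t htd] at h0
  norm_num at h0

/-- The crux with rule (1a) removed from the move set. -/
def ContinuousCubificationWithoutDomainAdd : Prop := ContinuousCubificationMod rulesNoDomainAdd

/-- **DOMAIN ADDITIVITY IS LOAD-BEARING for `ContinuousCubification`** (modulo van den Dries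
Ch. 4 (2.4)). [cite: Dries1998, Ch. 4 (2.4)] -/
theorem continuousCubification_false_without_domainAdd
    (hE : Dries1998_ch4_prop_2_4 Language.orderedRing ℝ) :
    ¬ ContinuousCubificationWithoutDomainAdd := fun h =>
  not_cubeNormalForm_rulesNoDomainAdd hE (cubeNormalForm_of_continuousCubificationMod h)

/-! ### Rule (1b), integrand additivity: redundant -/

/-- The subgroup generated by rules (1a), (2), (3) — everything except integrand additivity. -/
def rulesNoIntegrandAdd : AddSubgroup FormalRep :=
  AddSubgroup.closure (domainAddRel ∪ changeOfVariablesRel ∪ newtonLeibnizRel)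

/-- Rule (1b) is derivable from (1a) and (3) (tree: `relations_eq_closure_three_rules`, band/gluing
construction), so removing it changes nothing. [cite: KontsevichZagier2001, §1.2 rule (1)] -/
theorem rulesNoIntegrandAdd_eq_relations : rulesNoIntegrandAdd = relations :=
  (Summit.KontsevichZagierPeriods.Theorems.StuffleInKZ.Negative.Derived.relations_eq_closure_three_rules).symm

/-- The crux with rule (1b) removed from the move set. -/
def ContinuousCubificationWithoutIntegrandAdd : Prop := ContinuousCubificationMod rulesNoIntegrandAdd

/-- **Integrand additivity is NOT load-bearing**: the crux without rule (1b) is equivalent to the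
crux. [cite: KontsevichZagier2001, §1.2 rule (1)] -/
theorem continuousCubification_iff_without_integrandAdd :
    ContinuousCubificationWithoutIntegrandAdd ↔ ContinuousCubification := by
  rw [ContinuousCubificationWithoutIntegrandAdd, rulesNoIntegrandAdd_eq_relations]
  rfl

/-! ## The sign-respecting strengthening is summit-hard -/

/-- SIGN-RESPECTING continuous cubification: the normal form's integrand is non-negative whenever
the value is. A natural request (volumes!) — and summit-hard, see below. -/
def SignedContinuousCubification : Prop :=
  ∀ x : FormalRep, 0 ≤ eval x → ∃ (M : ℕ) (t : IntegralRep M),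
    t.domain = cube M ∧ ContinuousOn t.integrand t.domain ∧ (∀ z ∈ t.domain, 0 ≤ t.integrand z) ∧
      x - of t ∈ relations

/-- The closed cube is contained in the closure of its interior. [folklore] -/
theorem cube_subset_closure_interior (M : ℕ) : cube M ⊆ closure (interior (cube M)) := by
  rw [interior_pi_set Set.finite_univ, closure_pi_set]
  intro x hx
  rw [Set.mem_univ_pi] at hx ⊢
  intro i
  rw [interior_Icc, closure_Ioo zero_ne_one]
  exact hx i

/-- A continuous non-negative integrand on the closed cube with integral `0` vanishes on the
closed cube. [folklore] -/
theorem eqOn_zero_of_nonneg_of_value_eq_zero {M : ℕ} (t : IntegralRep M) (ht : t.domain = cube M)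
    (hc : ContinuousOn t.integrand t.domain) (hnn : ∀ z ∈ t.domain, 0 ≤ t.integrand z)
    (hv : t.value = 0) : EqOn t.integrand 0 t.domain := by
  have hmeas : MeasurableSet t.domain := IntegralRep.measurableSet_domain_holds t
  have hae : t.integrand =ᵐ[volume.restrict t.domain] 0 := by
    refine (setIntegral_eq_zero_iff_of_nonneg_ae ?_ t.integrableOn).1 hv
    exact (ae_restrict_iff' hmeas).2 (Filter.Eventually.of_forall hnn)
  have h := Measure.eqOn_of_ae_eq hae hc continuousOn_const (by rw [ht]; exact cube_subset_closure_interior M)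
  exact h

/-- **The sign-respecting strengthening implies the kernel conjecture** (hence the summit, tree
`KernelImpliesStatement`): for `eval x = 0` the normal form is a non-negative continuous integrand
of integral `0` on the closed cube, i.e. `0`, so `[t] ∈ relations` and `x ∈ relations`. The crux
itself asserts nothing about signs; planners should not strengthen it this way.
[cite: KontsevichZagier2001, §1.2 Conjecture 1] -/
theorem kzKernelConjecture_of_signed (h : SignedContinuousCubification) : KZKernelConjecture := by
  intro x hx
  obtain ⟨M, t, htd, htc, hnn, hrel⟩ := h x hx.ge
  have hv : t.value = 0 := by
    have h0 : eval (x - of t) = 0 := relations_le_ker_eval_holds hrel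
    rw [map_sub, hx, eval_of, zero_sub, neg_eq_zero] at h0
    exact h0
  have ht0 : of t ∈ relations :=
    of_mem_relations_of_eqOn_zero t (eqOn_zero_of_nonneg_of_value_eq_zero t htd htc hnn hv)
  have : x = (x - of t) + of t := by abel
  rw [this]
  exact relations.add_mem hrel ht0

end Summit.KontsevichZagierPeriods.UnfoldedStokes.ContinuousCubificationNegative

end
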